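import Literature.Topology.FourManifolds.SchoenfliesPlane
import Literature.Topology.FourManifolds.UnorientedDiscTheoremDiffeotopy
import Literature.Topology.FourManifolds.DiscTransport
import Literature.Topology.FourManifolds.ChartTransport
import Literature.Topology.FourManifolds.SmoothEmbeddingCriteria
import HarnessLib

/-!
# The smooth annulus theorem in the plane

Topic `Literature/Topology/FourManifolds`; a sequel of `SchoenfliesPlane.lean` (the smooth
Schoenflies theorem in `ℝ²`: a smooth Jordan curve is the boundary circle `e(𝕊¹)` of a smooth
embedding `e : ℝ² → ℝ²` of the whole plane).  **Everything in this file is proved; no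
definition and no named fact is introduced.**

* `SchoenfliesPlane.exists_annulus` — **the smooth annulus theorem in the plane.**  Let
  `e₀ : ℝ² → ℝ²` be a smooth embedding of the plane (e.g. the Schoenflies disc of an outer
  Jordan curve `C₀ = e₀(𝕊¹)`) and `γ : 𝕊¹ → ℝ²` a smooth embedding of the circle into the open
  disc `e₀(𝔹²)`.  Then there is a smooth embedding `e : ℝ² → ℝ²` of the plane with
  `e(∂B(0,2)) = e₀(𝕊¹)`, `e(𝕊¹) = γ(𝕊¹)`, `e(B̄(0,2)) = e₀(𝔻²)`, and `e x = e₀ (x/2)` for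
  `‖x‖ > 2ρ`, some `ρ < 1`.  So the closed region between two nested disjoint smooth Jordan
  curves is the diffeomorphic image of the round annulus `{1 ≤ ‖x‖ ≤ 2}`, by an embedding of
  the plane that is the (rescaled) outer Schoenflies disc near and beyond the outer curve —
  the form needed to write down isotopies of the plane / of a surface chart that sweep one of
  the two curves onto the other across the region between them (e.g. a meridian of a
  handlebody across a planar region of the boundary surface: the "wave" moves of cut systems,
  Hensel (2020), §5), or to thicken a Jordan curve inside a prescribed Jordan domain.
* Tools of independent use (§1): smooth embeddings `ℝ² → ℝ²` compose
  (`isSmoothEmbedding_comp_plane`; Mathlib's `IsSmoothEmbedding.comp` is a `proof_wanted`),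
  linear automorphisms of the plane are smooth embeddings (diffeomorphisms are, in general:
  `Diffeomorph.isSmoothEmbedding'`, `CerfGammaFourProofs.lean`), and the pull-back `Φ ∘ γ` of
  a smooth circle `γ` along a smooth embedding `φ = Φ.symm` of the plane is a smooth circle
  (`isSmoothEmbedding_chart_comp_circle`).

## Proof of the annulus theorem

Let `u : ℝ² ≅ 𝔹²` be the squeeze `x ↦ x/√(1 + ‖x‖²)` (`ClosedDiscExtension.squeeze 1`,
`SchoenfliesBallSide.lean`) and `φ = e₀ ∘ u`, a smooth embedding of the plane onto the open outer
domain `e₀(𝔹²)`.  Pull `γ` back to `γ' = φ⁻¹ ∘ γ` (`exists_chart_of_isSmoothEmbedding`), take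
the planar Schoenflies disc `e₁` of `γ'` (`SchoenfliesPlane.exists_isSmoothEmbedding`), and apply
the unoriented disc theorem with compactly supported diffeotopy
(`exists_isCompactlyDiffeotopicToIdIn_apply_disc_eq_or_reflect`, ambient `ℝ²`, `W = univ`) to
the discs `e₁` and `y ↦ y/√3`: a compactly supported diffeomorphism `F'` of the parameter plane
carries `γ'(𝕊¹)` onto the round circle of radius `1/√3` (up to a reflection, which preserves
round circles), and `u` maps that circle onto the circle of radius `1/2`.  Transported along `φ`
and extended by the identity (`exists_diffeomorph_discTransport`) `F'` becomes a diffeomorphism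
`F` of the plane, the identity off a compact subset of the open outer domain, with
`F(γ(𝕊¹)) = e₀(∂B(0, 1/2))`.  Then `e = F⁻¹ ∘ e₀ ∘ (x ↦ x/2)`.

## References

* M. W. Hirsch, *Differential Topology*, GTM 33 (1976), Ch. 9 §3, Thm. 3.6 and Exercise 2
  (curves on surfaces, discs and annuli); Ch. 8 §3, Thm. 3.1 (disc theorem). [HirschDT1976]
* J. Schultens, *Introduction to 3-Manifolds*, GSM 151 (2014), proof of Thm. 3.2.5 (isotoping
  level curves in planes). [Schultens2014]
* S. Hensel, *A primer on handlebody groups* (2020), §5 (cut systems and their moves — the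
  intended consumer). [Hensel2020HandlebodyPrimer]

## Design notes

* Pure theorems; the plane is `EuclideanSpace ℝ (Fin 2)`, the circle is
  `Metric.sphere (0 : EuclideanSpace ℝ (Fin (1 + 1))) 1` with its `𝓡 1` structure, as in
  `SchoenfliesPlane.lean`.
* The hypothesis on `e₀` is only that it is a smooth embedding of the plane: the construction
  never leaves `e₀(𝔻²)`; the conclusions `e(∂B(0,2)) = e₀(𝕊¹)`, `e(B̄(0,2)) = e₀(𝔻²)` transfer
  whatever is known about the outer disc (connected unbounded complement, …) to `e`.
* The radii `1 < 2` of the model annulus are normalised by `x ↦ x/2` and the target radius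
  `1/√3` in the parameter plane (`u` maps radius `1/√3` to radius `1/2`).
-/

open scoped Manifold ContDiff Topology
open Set Function Metric Module Filter Bornology

noncomputable section

namespace Literature.Topology.FourManifolds

namespace SchoenfliesPlane

/-! ### §1 Smooth embeddings of the plane into itself -/

section PlaneEmbeddings

/-- **Composition of smooth embeddings of the plane into itself** (both are injective local
diffeomorphisms, `Manifold.IsSmoothEmbedding.isLocalDiffeomorph_of_finrank_eq`, and so is the
composite, `isSmoothEmbedding_of_isLocalDiffeomorph`).  Mathlib's general
`IsSmoothEmbedding.comp` is a `proof_wanted`; this is the equidimensional planar case. [folklore] -/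
theorem isSmoothEmbedding_comp_plane
    {f g : EuclideanSpace ℝ (Fin 2) → EuclideanSpace ℝ (Fin 2)}
    (hf : Manifold.IsSmoothEmbedding (𝓡 2) (𝓡 2) ∞ f)
    (hg : Manifold.IsSmoothEmbedding (𝓡 2) (𝓡 2) ∞ g) :
    Manifold.IsSmoothEmbedding (𝓡 2) (𝓡 2) ∞ (g ∘ f) := by
  have hf' : IsLocalDiffeomorph (𝓡 2) (𝓡 2) ∞ f := hf.isLocalDiffeomorph_of_finrank_eq rfl
  have hg' : IsLocalDiffeomorph (𝓡 2) (𝓡 2) ∞ g := hg.isLocalDiffeomorph_of_finrank_eq rfl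
  have hgf : IsLocalDiffeomorph (𝓡 2) (𝓡 2) ∞ (g ∘ f) := fun x =>
    (hf' x).comp (K := 𝓡 2) (P := EuclideanSpace ℝ (Fin 2)) (hg' (f x))
  exact isSmoothEmbedding_of_isLocalDiffeomorph hgf
    (hg.isEmbedding.injective.comp hf.isEmbedding.injective)
    (ContinuousLinearEquiv.refl ℝ (EuclideanSpace ℝ (Fin 2)))

/-- A continuous linear automorphism of the plane is a smooth embedding of the plane into
itself (via its diffeomorphism `L.toDiffeomorph` and `Diffeomorph.isSmoothEmbedding'`,
`CerfGammaFourProofs.lean`). [folklore] -/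
theorem isSmoothEmbedding_continuousLinearEquiv_plane
    (L : EuclideanSpace ℝ (Fin 2) ≃L[ℝ] EuclideanSpace ℝ (Fin 2)) :
    Manifold.IsSmoothEmbedding (𝓡 2) (𝓡 2) ∞ L :=
  L.toDiffeomorph.isSmoothEmbedding'

/-- **Pull-back of a smooth circle along a smooth embedding of the plane.**  Let `φ : ℝ² → ℝ²`
be a smooth embedding, `Φ` a smooth chart inverting it (`Φ.symm = φ`, `Φ.source = range φ`, as
produced by `exists_chart_of_isSmoothEmbedding`) and `γ : 𝕊¹ → ℝ²` a smooth embedding with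
`γ(𝕊¹) ⊆ φ(ℝ²)`.  Then `Φ ∘ γ : 𝕊¹ → ℝ²` is a smooth embedding (immersion criterion on the
compact circle; `dΦ` is injective on `Φ.source`). [folklore] -/
theorem isSmoothEmbedding_chart_comp_circle
    {φ : EuclideanSpace ℝ (Fin 2) → EuclideanSpace ℝ (Fin 2)}
    (hφ : Manifold.IsSmoothEmbedding (𝓡 2) (𝓡 2) ∞ φ)
    (Φ : OpenPartialHomeomorph (EuclideanSpace ℝ (Fin 2)) (EuclideanSpace ℝ (Fin 2)))
    (hΦsymm : ⇑Φ.symm = φ) (hΦsrc : Φ.source = range φ)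
    (hΦc : ContMDiffOn (𝓡 2) (𝓡 2) ∞ Φ Φ.source)
    {γ : (sphere (0 : EuclideanSpace ℝ (Fin (1 + 1))) 1) → EuclideanSpace ℝ (Fin 2)}
    (hγ : Manifold.IsSmoothEmbedding (𝓡 1) (𝓡 2) ∞ γ) (hγφ : range γ ⊆ range φ) :
    Manifold.IsSmoothEmbedding (𝓡 1) (𝓡 2) ∞ (Φ ∘ γ) := by
  have hmem : ∀ x, γ x ∈ Φ.source := fun x => hΦsrc ▸ hγφ (mem_range_self x)
  have hc : ContMDiff (𝓡 1) (𝓡 2) ∞ (Φ ∘ γ) := hΦc.comp_contMDiff hγ.contMDiff hmem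
  have hMD : Φ.MDifferentiable (𝓡 2) (𝓡 2) := by
    refine ⟨hΦc.mdifferentiableOn (by simp), ?_⟩
    rw [hΦsymm]
    exact (hφ.contMDiff.mdifferentiable (by simp)).mdifferentiableOn
  refine isSmoothEmbedding_of_injective_of_injective_mfderiv hc (by exact_mod_cast le_top)
    (fun x y hxy => hγ.isEmbedding.injective (Φ.injOn (hmem x) (hmem y) hxy)) fun x => ?_
  have h1 : MDifferentiableAt (𝓡 1) (𝓡 2) γ x := (hγ.contMDiff x).mdifferentiableAt (by simp)
  have h2 : MDifferentiableAt (𝓡 2) (𝓡 2) Φ (γ x) :=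
    ((hΦc _ (hmem x)).contMDiffAt (Φ.open_source.mem_nhds (hmem x))).mdifferentiableAt (by simp)
  rw [mfderiv_comp x h2 h1]
  exact (hMD.mfderiv_injective (hmem x)).comp
    (injective_mfderiv_of_isImmersionAt' (hγ.isImmersion.isImmersionAt x))

end PlaneEmbeddings

/-! ### §2 The annulus theorem -/

section Annulus


/-- A reflection of the plane: a linear isometry of negative determinant (the device of
`DiscSmoothingRelBoundary.lean`, `exists_linearIsometryEquiv_det_neg`, copied to keep the
imports light). [folklore] -/
theorem exists_linearIsometryEquiv_det_neg_plane :
    ∃ r : (EuclideanSpace ℝ (Fin 2)) ≃ₗᵢ[ℝ] (EuclideanSpace ℝ (Fin 2)),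
      LinearMap.det (r.toContinuousLinearEquiv.toLinearEquiv :
        EuclideanSpace ℝ (Fin 2) →ₗ[ℝ] EuclideanSpace ℝ (Fin 2)) < 0 := by
  set v : (EuclideanSpace ℝ (Fin 2)) := EuclideanSpace.single (0 : Fin 2) (1 : ℝ) with hv_def
  have hv : v ≠ 0 := by
    intro h
    have := congr_fun (congrArg (fun w : (EuclideanSpace ℝ (Fin 2)) => (w : Fin 2 → ℝ)) h) 0
    simp [hv_def] at this
  refine ⟨(ℝ ∙ v)ᗮ.reflection, ?_⟩
  have h := ((ℝ ∙ v)ᗮ).det_reflection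
  rw [Submodule.orthogonal_orthogonal, finrank_span_singleton hv, pow_one] at h
  have h' : LinearMap.det (((ℝ ∙ v)ᗮ.reflection).toContinuousLinearEquiv.toLinearEquiv :
      (EuclideanSpace ℝ (Fin 2)) →ₗ[ℝ] (EuclideanSpace ℝ (Fin 2))) = -1 := h
  rw [h']
  norm_num

/-- If a bijection `F` fixes every point outside `C` and `C ⊆ D`, then `F(D) = D`. [folklore] -/
theorem image_eq_self_of_apply_eq_self_of_not_mem {α : Type*} (F : α ≃ α) {C D : Set α}
    (hF : ∀ x, x ∉ C → F x = x) (hCD : C ⊆ D) : F '' D = D := by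
  ext y
  constructor
  · rintro ⟨x, hx, rfl⟩
    by_cases hxC : x ∈ C
    · by_contra h
      have h1 : F x ∉ C := fun h' => h (hCD h')
      have h3 : F x = x := F.injective (hF _ h1)
      exact h1 (h3.symm ▸ hxC)
    · rw [hF x hxC]
      exact hx
  · intro hy
    by_cases hyC : y ∈ C
    · refine ⟨F.symm y, ?_, F.apply_symm_apply y⟩
      by_contra h
      have h1 : F.symm y ∉ C := fun h' => h (hCD h')
      have h2 : F (F.symm y) = F.symm y := hF _ h1
      rw [F.apply_symm_apply] at h2
      exact h1 (h2 ▸ hyC)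
    · exact ⟨y, hy, hF y hyC⟩

/-- The radius `1/√3` is squeezed to the radius `1/2`: `(1/√3) / √(1 + 1/3) = 1/2`.
[folklore] -/
theorem inv_sqrt_three_div_sqrt : (√3)⁻¹ / √(1 + ((√3)⁻¹) ^ 2) = 1 / 2 := by
  have hsq3 : (√3) ^ 2 = 3 := Real.sq_sqrt (by norm_num)
  have h3 : (0 : ℝ) < √3 := Real.sqrt_pos.2 (by norm_num)
  have h43 : 1 + ((√3)⁻¹) ^ 2 = (2 / √3) ^ 2 := by
    field_simp
    rw [hsq3]; norm_num
  rw [h43, Real.sqrt_sq (by positivity)]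
  field_simp

/-- **The smooth annulus theorem in the plane.**  Let `e₀ : ℝ² → ℝ²` be a smooth embedding of
the plane (for instance a Schoenflies parametrisation of a smooth Jordan curve `C₀ = e₀(𝕊¹)`,
`exists_isSmoothEmbedding_euclidean`) and `γ : 𝕊¹ → ℝ²` a smooth embedding of the circle into
the OPEN disc `e₀(𝔹²)`.  Then there is a smooth embedding `e : ℝ² → ℝ²` of the plane with

* `e(∂B(0, 2)) = e₀(𝕊¹)` — the outer circle of the round annulus `{1 ≤ ‖x‖ ≤ 2}` goes to `C₀`,
* `e(𝕊¹) = γ(𝕊¹)` — the inner circle goes to `C₁ = γ(𝕊¹)`,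
* `e(B̄(0, 2)) = e₀(𝔻²)` — so `e` maps the closed round annulus onto the region between the
  curves and the open unit disc onto the inner Jordan domain of `C₁`,
* and `e(x) = e₀(x/2)` for `‖x‖ > 2ρ`, some `ρ < 1`: near and beyond the outer circle `e` is
  the rescaled `e₀` (only the inside has been re-parametrised).

In particular the closed region between two nested disjoint smooth Jordan curves is a smoothly
embedded round annulus (the smooth annulus theorem in the plane, Hirsch (1976), Ch. 9 §3,
Exercise 2 ff.; Schultens (2014), proof of Thm. 3.2.5 for the isotopies in level planes).

Proof: see the module docstring.
[cite: HirschDT1976, Ch. 9 §3, Thm. 3.6 and Exercise 2]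
[cite: Schultens2014, proof of Thm. 3.2.5 (PDF pp. 44–45)] -/
theorem exists_annulus {e₀ : EuclideanSpace ℝ (Fin 2) → EuclideanSpace ℝ (Fin 2)}
    (he₀ : Manifold.IsSmoothEmbedding (𝓡 2) (𝓡 2) ∞ e₀)
    {γ : (sphere (0 : EuclideanSpace ℝ (Fin (1 + 1))) 1) → EuclideanSpace ℝ (Fin 2)}
    (hγ : Manifold.IsSmoothEmbedding (𝓡 1) (𝓡 2) ∞ γ) (hin : range γ ⊆ e₀ '' ball 0 1) :
    ∃ e : EuclideanSpace ℝ (Fin 2) → EuclideanSpace ℝ (Fin 2),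
      Manifold.IsSmoothEmbedding (𝓡 2) (𝓡 2) ∞ e ∧
      e '' sphere 0 2 = e₀ '' sphere 0 1 ∧ e '' sphere 0 1 = range γ ∧
      e '' closedBall 0 2 = e₀ '' closedBall 0 1 ∧
      ∃ ρ : ℝ, 0 < ρ ∧ ρ < 1 ∧
        ∀ x : EuclideanSpace ℝ (Fin 2), 2 * ρ < ‖x‖ → e x = e₀ ((1 / 2 : ℝ) • x) := by
  -- the squeeze and the chart `φ = e₀ ∘ u` of the open outer domain
  set u : EuclideanSpace ℝ (Fin 2) → EuclideanSpace ℝ (Fin 2) :=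
    ClosedDiscExtension.squeeze (F := EuclideanSpace ℝ (Fin 2)) 1 with hu
  have hue : Manifold.IsSmoothEmbedding (𝓡 2) (𝓡 2) ∞ u :=
    isSmoothEmbedding_of_isLocalDiffeomorph (ClosedDiscExtension.isLocalDiffeomorph_squeeze one_pos)
      (ClosedDiscExtension.injective_squeeze 1)
      (ContinuousLinearEquiv.refl ℝ (EuclideanSpace ℝ (Fin 2)))
  set φ : (EuclideanSpace ℝ (Fin 2)) → (EuclideanSpace ℝ (Fin 2)) := e₀ ∘ u with hφ_def
  have hφ : Manifold.IsSmoothEmbedding (𝓡 2) (𝓡 2) ∞ φ := isSmoothEmbedding_comp_plane hue he₀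
  have hrangeφ : range φ = e₀ '' ball 0 1 := by
    rw [hφ_def, range_comp, hu, ClosedDiscExtension.range_squeeze one_pos]
  obtain ⟨Φ, -, hΦsymm, hΦsrc, hΦc⟩ := exists_chart_of_isSmoothEmbedding hφ
  have hinφ : range γ ⊆ range φ := hrangeφ ▸ hin
  -- pull back the inner circle and take its Schoenflies disc
  set γ' : (sphere (0 : EuclideanSpace ℝ (Fin (1 + 1))) 1) → EuclideanSpace ℝ (Fin 2) := Φ ∘ γ
    with hγ'_def
  have hγ' : Manifold.IsSmoothEmbedding (𝓡 1) (𝓡 2) ∞ γ' :=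
    isSmoothEmbedding_chart_comp_circle hφ Φ hΦsymm hΦsrc hΦc hγ hinφ
  have hφγ' : ∀ x, φ (γ' x) = γ x := fun x => by
    have hx : γ x ∈ Φ.source := hΦsrc ▸ hinφ (mem_range_self x)
    rw [← hΦsymm]
    exact Φ.left_inv hx
  have hrangeγ : range γ = φ '' range γ' := by
    ext z
    simp only [mem_range, mem_image, exists_exists_eq_and, hφγ']
  obtain ⟨e₁, he₁, he₁S, -, -⟩ :=
    exists_isSmoothEmbedding (F := (EuclideanSpace ℝ (Fin 2))) finrank_euclideanSpace_fin hγ'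
  -- the standard disc `y ↦ c • y`, `c = 1/√3`
  set c : ℝ := (√3)⁻¹ with hc_def
  have hc0 : 0 < c := inv_pos.2 (Real.sqrt_pos.2 (by norm_num))
  set L : EuclideanSpace ℝ (Fin 2) ≃L[ℝ] EuclideanSpace ℝ (Fin 2) :=
    ContinuousLinearEquiv.smulLeft (Units.mk0 c hc0.ne') with hL_def
  have hL : ∀ y : (EuclideanSpace ℝ (Fin 2)), L y = c • y := fun y => by
    rw [hL_def, ContinuousLinearEquiv.smulLeft_apply_apply, Units.smul_mk0]
  have hLe : Manifold.IsSmoothEmbedding (𝓡 2) (𝓡 2) ∞ L :=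
    isSmoothEmbedding_continuousLinearEquiv_plane L
  -- the disc theorem in the parameter plane, with full support allowed
  obtain ⟨r, hr⟩ := exists_linearIsometryEquiv_det_neg_plane
  obtain ⟨F', hF'd, hF'⟩ := exists_isCompactlyDiffeotopicToIdIn_apply_disc_eq_or_reflect
    (M := EuclideanSpace ℝ (Fin 2)) he₁ hLe r.toContinuousLinearEquiv hr isOpen_univ
    isPreconnected_univ
    (subset_univ _) (subset_univ _)
  -- `F'` rounds the pulled-back inner circle to the circle of radius `c`
  have hcsphere :
      (fun y : EuclideanSpace ℝ (Fin 2) => c • y) '' sphere (0 : EuclideanSpace ℝ (Fin 2)) 1 =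
        sphere 0 c := by
    rw [image_smul, smul_sphere' hc0.ne', smul_zero, Real.norm_of_nonneg hc0.le, mul_one]
  have hF'sphere : F' '' range γ' = sphere 0 c := by
    rw [← he₁S]
    rcases hF' with h | h
    · rw [image_image, ← hcsphere]
      exact image_congr fun y hy => by
        rw [h y (mem_sphere_zero_iff_norm.1 hy).le, hL]
    · have hrs : (r : EuclideanSpace ℝ (Fin 2) → EuclideanSpace ℝ (Fin 2)) '' sphere 0 1 =
          sphere 0 1 := by
        rw [show (r : EuclideanSpace ℝ (Fin 2) → EuclideanSpace ℝ (Fin 2)) = r.toIsometryEquiv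
          from rfl, IsometryEquiv.image_sphere]
        simp
      rw [← hrs, image_image, image_image, ← hcsphere]
      exact image_congr fun y hy => by
        have h' := h y (mem_sphere_zero_iff_norm.1 hy).le
        rw [hL] at h'
        exact h'
  -- support of `F'`
  obtain ⟨D, K, hK, -, hD1, hDK⟩ := hF'd
  have hF'id : ∀ x, x ∉ K → F' x = x := fun x hx => by
    rw [← hD1]
    exact hDK 1 x hx
  obtain ⟨R, hKR⟩ := hK.isBounded.subset_closedBall 0
  set R₁ : ℝ := max R 0 + 1 with hR₁
  have hR₁pos : 0 < R₁ := by rw [hR₁]; positivity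
  have hF'id' : ∀ y, R₁ ≤ ‖y‖ → F' y = y := fun y hy => hF'id y fun hyK => by
    have h1 := hKR hyK
    rw [mem_closedBall_zero_iff] at h1
    have h2 : R ≤ max R 0 := le_max_left _ _
    linarith
  -- transport along `φ`
  obtain ⟨F, hFφ, hFid⟩ := exists_diffeomorph_discTransport hφ F' hF'id'
  -- notation for the sets
  have hCφ : φ '' closedBall (0 : EuclideanSpace ℝ (Fin 2)) R₁ ⊆ e₀ '' ball 0 1 :=
    hrangeφ ▸ image_subset_range _ _
  have hFfix : ∀ b, b ∉ e₀ '' ball (0 : EuclideanSpace ℝ (Fin 2)) 1 → F b = b :=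
    fun b hb => hFid b fun h => hb (hCφ h)
  have hFsfix : ∀ b, b ∉ e₀ '' ball (0 : EuclideanSpace ℝ (Fin 2)) 1 → F.symm b = b :=
      fun b hb => by
    conv_lhs => rw [← hFfix b hb]
    exact F.symm_apply_apply b
  have hFsfix' : ∀ b, b ∉ φ '' closedBall (0 : EuclideanSpace ℝ (Fin 2)) R₁ → F.symm b = b :=
      fun b hb => by
    conv_lhs => rw [← hFid b hb]
    exact F.symm_apply_apply b
  -- the half-scaling and the embedding `e`
  have h20 : (1 / 2 : ℝ) ≠ 0 := by norm_num
  set L₂ : EuclideanSpace ℝ (Fin 2) ≃L[ℝ] EuclideanSpace ℝ (Fin 2) :=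
    ContinuousLinearEquiv.smulLeft (Units.mk0 (1 / 2 : ℝ) h20) with hL₂_def
  have hL₂ : ∀ x : (EuclideanSpace ℝ (Fin 2)), L₂ x = (1 / 2 : ℝ) • x := fun x => by
    rw [hL₂_def, ContinuousLinearEquiv.smulLeft_apply_apply, Units.smul_mk0]
  have hL₂e : Manifold.IsSmoothEmbedding (𝓡 2) (𝓡 2) ∞ L₂ :=
    isSmoothEmbedding_continuousLinearEquiv_plane L₂
  have hL₂fun :
      (L₂ : EuclideanSpace ℝ (Fin 2) → EuclideanSpace ℝ (Fin 2)) = fun x => (1 / 2 : ℝ) • x :=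
    funext hL₂
  set e : EuclideanSpace ℝ (Fin 2) → EuclideanSpace ℝ (Fin 2) := F.symm ∘ (e₀ ∘ L₂) with he_def
  have he : Manifold.IsSmoothEmbedding (𝓡 2) (𝓡 2) ∞ e :=
    isSmoothEmbedding_comp_plane (isSmoothEmbedding_comp_plane hL₂e he₀) F.symm.isSmoothEmbedding'
  have hnorm2 : ‖(1 / 2 : ℝ)‖ = 1 / 2 := by rw [Real.norm_of_nonneg (by norm_num)]
  have hL₂sphere2 : (L₂ : EuclideanSpace ℝ (Fin 2) → EuclideanSpace ℝ (Fin 2)) '' sphere 0 2 =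
      sphere 0 1 := by
    rw [hL₂fun, image_smul, smul_sphere' h20, smul_zero, hnorm2]; norm_num
  have hL₂sphere1 : (L₂ : EuclideanSpace ℝ (Fin 2) → EuclideanSpace ℝ (Fin 2)) '' sphere 0 1 =
      sphere 0 (1 / 2) := by
    rw [hL₂fun, image_smul, smul_sphere' h20, smul_zero, hnorm2]; norm_num
  have hL₂cball : (L₂ : EuclideanSpace ℝ (Fin 2) → EuclideanSpace ℝ (Fin 2)) '' closedBall 0 2 =
      closedBall 0 1 := by
    rw [hL₂fun, image_smul, smul_closedBall' h20, smul_zero, hnorm2]; norm_num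
  refine ⟨e, he, ?_, ?_, ?_, ?_⟩
  · -- the outer circle
    rw [he_def, image_comp, image_comp, hL₂sphere2]
    refine EqOn.image_eq_self fun b hb => hFsfix b fun hb' => ?_
    exact Set.disjoint_left.1 (disjoint_image_sphere_ball he₀.isEmbedding.injective) hb hb'
  · -- the inner circle
    rw [he_def, image_comp, image_comp, hL₂sphere1]
    have hFγ : F '' range γ = e₀ '' sphere 0 (1 / 2) := by
      rw [hrangeγ, image_image]
      have : (fun x => F (φ x)) '' range γ' = φ '' (F' '' range γ') := by
        rw [image_image]; exact image_congr fun y _ => hFφ y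
      rw [this, hF'sphere, hφ_def, image_comp, hu,
        ClosedDiscExtension.image_squeeze_sphere one_pos hc0.le, one_mul, hc_def,
        inv_sqrt_three_div_sqrt]
    rw [← hFγ, ← image_comp]
    show (F.symm ∘ F) '' range γ = range γ
    have : (F.symm ∘ F : EuclideanSpace ℝ (Fin 2) → EuclideanSpace ℝ (Fin 2)) = id :=
      funext fun x => F.symm_apply_apply x
    rw [this, image_id]
  · -- the closed discs
    rw [he_def, image_comp, image_comp, hL₂cball]
    exact image_eq_self_of_apply_eq_self_of_not_mem F.symm.toEquiv hFsfix'
      (hCφ.trans (image_mono ball_subset_closedBall))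
  · -- near and beyond the outer circle `e = e₀ ∘ (x ↦ x/2)`
    set ρ : ℝ := R₁ / √(1 + R₁ ^ 2) with hρ
    have hsq : 0 < √(1 + R₁ ^ 2) := Real.sqrt_pos.2 (by positivity)
    have hρ1 : ρ < 1 := by
      rw [hρ, div_lt_one hsq]
      have : R₁ ^ 2 < (√(1 + R₁ ^ 2)) ^ 2 := by rw [Real.sq_sqrt (by positivity)]; linarith
      exact lt_of_pow_lt_pow_left₀ 2 hsq.le this
    have huball : u '' closedBall (0 : EuclideanSpace ℝ (Fin 2)) R₁ = closedBall 0 ρ := by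
      rw [hu, ClosedDiscExtension.image_squeeze_closedBall one_pos hR₁pos.le, one_mul]
    refine ⟨ρ, by positivity, hρ1, fun x hx => ?_⟩
    show F.symm (e₀ (L₂ x)) = e₀ ((1 / 2 : ℝ) • x)
    rw [hL₂]
    refine hFsfix' _ ?_
    rintro ⟨y, hy, hyx⟩
    rw [hφ_def, Function.comp_apply] at hyx
    have hyx' : u y = (1 / 2 : ℝ) • x := he₀.isEmbedding.injective hyx
    have h1 : u y ∈ closedBall (0 : EuclideanSpace ℝ (Fin 2)) ρ := huball ▸ mem_image_of_mem u hy
    rw [hyx', mem_closedBall_zero_iff, norm_smul, hnorm2] at h1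
    linarith

end Annulus

end SchoenfliesPlane

end Literature.Topology.FourManifolds

end
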